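import Mathlib
import HarnessLib
import Literature.Probability.MarkovChains.MultipleTryIndependenceSampler
import Literature.Probability.MarkovChains.IndependenceMultiproposalGapBound
import Literature.Probability.MarkovChains.DataAugmentationAutocovariance

/-!
# i-SIR is a two-component Gibbs sampler on (state, pool): its kernel is reversible and POSITIVE,
# and its asymptotic variance is at least the independent-sampling variance (finite state spaces)

[cite: AndrieuLeeVihola2018, §3 Theorem 1 (first bullet: for `N ≥ 2` the kernel `P_N` "is
reversible with respect to `π` and defines a positive operator"; third display, lower bound:
"`var_π(f) ≤ var(f, P_N)`"), §1 (first bullet: "the i-SIR Markov chain has non-negative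
stationary autocorrelations")]; the mechanism is the one named in
[cite: SamsonovEtAl2022, §2.1 ("Interpreting i-SIR as a systematic-scan two-stage Gibbs sampler
… it follows easily that the Markov kernel is reversible w.r.t. the target")].

The i-SIR update of the tree (`MultipleTryIndependenceSampler.isirKernel q p (n + 1)`: keep the
current state in the pool, add `n + 1` fresh proposals from `q`, select from the pool of size
`N = n + 2` with probability `∝ w = p/q`) is the marginal chain of a DATA-AUGMENTATION scheme in
the sense of `DataAugmentationAutocovariance.lean`: the augmented variable is the whole pool
`u ∈ X^N`, with joint law `J(x, u) = (1/N) Σ_k 1{u_k = x} · w(x) · ∏_j q(u_j)` ("`x ∼ p` sits at a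
uniformly chosen position of a pool whose other members are i.i.d. `q`"); its `x`-marginal is `p`,
its `u`-conditional given `x` is "insert `x`, refresh the rest", and its `x`-conditional given `u`
is selection `∝ w` — so `daKernel J = P_N`.  Consequently (Liu–Wong–Kong, typed in
`DataAugmentationAutocovariance.lean`) `P_N` is a positive operator on `ℓ²(p)` and
`var_p(f) ≤ v(f, p, P_N)` for every `f`.

## Content

* `poolCount`, `isirJoint` — the objects above; `sum_isirJoint_pool` (`x`-marginal `= p`),
  `sum_isirJoint_state` (`u`-marginal `= ∏q · Σw / N`).
* `sum_trialProb_mul_poolCount_mul` — the exchangeability identity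
  `Σ_u ∏q(u) · #{k : u_k = x} · G(u) = N q(x) Σ_{ys} ∏q(ys) · G(x :: ys)` for symmetric `G`.
* `isirKernel_eq_sum_cons` — `P_N(x, y) = w(y) Σ_{ys} ∏q(ys) #{pool members = y}/(w(x) + Σ w(ys))`.
* **`daKernel_isirJoint`** — `daKernel (isirJoint q p n) = isirKernel q p (n + 1)`.
* **`piInner_isirKernel_mulVec_nonneg`** — POSITIVITY: `⟨h, P_N h⟩_p ≥ 0` for every `h`.
* **`var_le_asympVar_isir`** — `var_p(f) ≤ v(f, p, P_N)`: i-SIR never beats independent sampling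
  from `p` in asymptotic variance (the lower half of Andrieu–Lee–Vihola's variance sandwich; the
  upper half is `MinorizationAsymptoticVariance.asympVar_isir_le`).

NOT CLAIMED: general state spaces; the iterated conditional SMC (`T > 1`).
-/

namespace Literature.Probability.MarkovChains

open Finset Matrix

variable {X : Type*} [Fintype X] [DecidableEq X] {p q : X → ℝ}

/-! ## Pools -/

/-- The number of positions of the pool `u` carrying the value `x` (as a real number).
[cite: AndrieuLeeVihola2018, §4 (the representation of `P_N` as a sum over the position `k` of the
selected particle)] -/
noncomputable def poolCount {N : ℕ} (x : X) (u : Fin N → X) : ℝ := ∑ k, if u k = x then 1 else 0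

/-- The joint law of (state, pool) under which i-SIR is a two-component Gibbs sampler:
`J(x, u) = ∏_j q(u_j) · w(x) · #{k : u_k = x} / N`, `N = n + 2` — the state `x ∼ p` occupies a
uniformly distributed position of the pool and the other `N − 1` members are i.i.d. from `q`.
[cite: SamsonovEtAl2022, §2.1 (i-SIR as "a systematic-scan two-stage Gibbs sampler")];
[cite: AndrieuLeeVihola2018, §3 Theorem 1 (first bullet)] -/
noncomputable def isirJoint (q p : X → ℝ) (n : ℕ) (x : X) (u : Fin (n + 2) → X) : ℝ :=
  trialProb q u * (p x / q x) * poolCount x u / (n + 2)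

section Helpers

omit [Fintype X] [DecidableEq X] in
/-- `∏ q(u ∘ σ) = ∏ q(u)` for a permutation of the positions (helper). [folklore] -/
private theorem trialProb_comp_perm (q : X → ℝ) {N : ℕ} (u : Fin N → X) (σ : Equiv.Perm (Fin N)) :
    trialProb q (u ∘ σ) = trialProb q u := by
  unfold trialProb
  exact Equiv.prod_comp σ (fun i => q (u i))

omit [Fintype X] [DecidableEq X] in
/-- `Σ w(u ∘ σ) = Σ w(u)` (helper). [folklore] -/
private theorem weightSum_comp_perm (q p : X → ℝ) {N : ℕ} (u : Fin N → X)
    (σ : Equiv.Perm (Fin N)) : weightSum q p (u ∘ σ) = weightSum q p u := by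
  unfold weightSum
  exact Equiv.sum_comp σ (fun i => p (u i) / q (u i))

omit [Fintype X] in
/-- `#{k : (u ∘ σ)_k = x} = #{k : u_k = x}` (helper). [folklore] -/
private theorem poolCount_comp_perm {N : ℕ} (x : X) (u : Fin N → X) (σ : Equiv.Perm (Fin N)) :
    poolCount x (u ∘ σ) = poolCount x u := by
  unfold poolCount
  exact Equiv.sum_comp σ (fun i => if u i = x then (1 : ℝ) else 0)

omit [Fintype X] [DecidableEq X] in
/-- `∏ q(a :: ys) = q(a) ∏ q(ys)` (helper). [folklore] -/
private theorem trialProb_cons (q : X → ℝ) {n : ℕ} (a : X) (ys : Fin n → X) :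
    trialProb q (Fin.cons a ys : Fin (n + 1) → X) = q a * trialProb q ys := by
  unfold trialProb
  rw [Fin.prod_univ_succ]
  simp

omit [Fintype X] [DecidableEq X] in
/-- `Σ w(a :: ys) = w(a) + Σ w(ys)` (helper). [folklore] -/
private theorem weightSum_cons (q p : X → ℝ) {n : ℕ} (a : X) (ys : Fin n → X) :
    weightSum q p (Fin.cons a ys : Fin (n + 1) → X) = p a / q a + weightSum q p ys := by
  unfold weightSum
  rw [Fin.sum_univ_succ]
  simp

omit [Fintype X] in
/-- `#{members of a :: ys equal to y} = 1{a = y} + #{J : ys_J = y}` (helper). [folklore] -/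
private theorem poolCount_cons {n : ℕ} (y a : X) (ys : Fin n → X) :
    poolCount y (Fin.cons a ys : Fin (n + 1) → X) =
      (if a = y then 1 else 0) + ∑ J, if ys J = y then (1 : ℝ) else 0 := by
  unfold poolCount
  rw [Fin.sum_univ_succ]
  simp

omit [Fintype X] in
/-- `#{k : u_k = x} ≥ 0` (helper). [folklore] -/
private theorem poolCount_nonneg {N : ℕ} (x : X) (u : Fin N → X) : 0 ≤ poolCount x u :=
  sum_nonneg fun k _ => by split_ifs <;> norm_num

omit [Fintype X] [DecidableEq X] in
/-- `∏ q(u) > 0` (helper). [folklore] -/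
private theorem trialProb_pos' (hq : ∀ x, 0 < q x) {N : ℕ} (u : Fin N → X) : 0 < trialProb q u := by
  unfold trialProb
  exact prod_pos fun i _ => hq _

omit [Fintype X] [DecidableEq X] in
/-- `Σ w(u) ≥ 0` (helper). [folklore] -/
private theorem weightSum_nonneg'' (hp : ∀ x, 0 < p x) (hq : ∀ x, 0 < q x) {N : ℕ}
    (u : Fin N → X) : 0 ≤ weightSum q p u := by
  unfold weightSum
  exact sum_nonneg fun i _ => (div_pos (hp _) (hq _)).le

omit [Fintype X] [DecidableEq X] in
/-- `Σ w(u) > 0` for a non-empty pool (helper). [folklore] -/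
private theorem weightSum_pos' (hp : ∀ x, 0 < p x) (hq : ∀ x, 0 < q x) {n : ℕ}
    (u : Fin (n + 1) → X) : 0 < weightSum q p u := by
  unfold weightSum
  exact sum_pos (fun i _ => div_pos (hp _) (hq _)) univ_nonempty

/-- `Σ_u 1{u_k = x} ∏ q(u) = q(x)`: the `k`-th marginal of an i.i.d. pool
(`IndependenceMultiproposalGapBound.mpMarginal_iid`). [cite: PozzaZanella2025, §2 Example 1] -/
private theorem sum_ite_trialProb (hq1 : ∑ x, q x = 1) {N : ℕ} (k : Fin N) (x : X) :
    ∑ u : Fin N → X, (if u k = x then trialProb q u else 0) = q x := by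
  have h := mpMarginal_iid (q := q) hq1 k x x
  unfold mpMarginal at h
  exact h

end Helpers

/-! ## Marginals of the joint law -/

/-- **The state marginal of `J` is the target**: `Σ_u J(x, u) = p(x)`.
[cite: AndrieuLeeVihola2018, §3 Theorem 1 (reversibility with respect to `π`)];
[cite: SamsonovEtAl2022, §2.1] -/
theorem sum_isirJoint_pool (hq : ∀ x, 0 < q x) (hq1 : ∑ x, q x = 1) (n : ℕ) (x : X) :
    ∑ u : Fin (n + 2) → X, isirJoint q p n x u = p x := by
  unfold isirJoint
  have h1 : ∑ u : Fin (n + 2) → X, trialProb q u * poolCount x u = (n + 2) * q x := by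
    unfold poolCount
    simp_rw [mul_sum, mul_ite, mul_one, mul_zero]
    rw [sum_comm]
    simp_rw [sum_ite_trialProb hq1]
    rw [sum_const, card_univ, Fintype.card_fin, nsmul_eq_mul]
    push_cast
    ring
  have h2 : ∀ u : Fin (n + 2) → X, trialProb q u * (p x / q x) * poolCount x u / (n + 2) =
      (p x / q x) / (n + 2) * (trialProb q u * poolCount x u) := fun u => by ring
  simp_rw [h2]
  rw [← mul_sum, h1]
  have hqx : q x ≠ 0 := (hq x).ne'
  have hN : (n : ℝ) + 2 ≠ 0 := by positivity
  rw [div_div, mul_comm ((n : ℝ) + 2) (q x), div_mul_cancel₀ _ (mul_ne_zero hqx hN)]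

omit [DecidableEq X] in
/-- `Σ_x w(x) #{k : u_k = x} = Σ_k w(u_k)` (fibrewise summation). [folklore] -/
private theorem sum_weight_mul_poolCount [DecidableEq X] (q p : X → ℝ) {N : ℕ} (u : Fin N → X) :
    ∑ x, p x / q x * poolCount x u = weightSum q p u := by
  unfold poolCount weightSum
  simp_rw [mul_sum, mul_ite, mul_one, mul_zero]
  rw [sum_comm]
  exact sum_congr rfl fun k _ => by rw [sum_ite_eq univ (u k), if_pos (mem_univ _)]

/-- **The pool marginal of `J`**: `Σ_x J(x, u) = ∏ q(u) · Σ_k w(u_k) / N`.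
[cite: SamsonovEtAl2022, §2.1]; [cite: AndrieuLeeVihola2018, §4] -/
theorem sum_isirJoint_state (q p : X → ℝ) (n : ℕ) (u : Fin (n + 2) → X) :
    ∑ x, isirJoint q p n x u = trialProb q u * weightSum q p u / (n + 2) := by
  unfold isirJoint
  rw [← sum_weight_mul_poolCount q p u, mul_sum, sum_div]
  exact sum_congr rfl fun x _ => by ring

/-! ## The exchangeability identity and the kernel -/

/-- **Exchangeability**: for a function `G` of the pool that is symmetric under permutations of the
positions, `Σ_u ∏q(u) · #{k : u_k = x} · G(u) = N · q(x) · Σ_{ys} ∏q(ys) · G(x :: ys)` — each of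
the `N` positions that may carry `x` contributes the same amount, computed with `x` moved to the
front. [cite: AndrieuLeeVihola2018, §4 (the `k = 1` / `k ≠ 1` decomposition of `P_N`)] -/
theorem sum_trialProb_mul_poolCount_mul (q : X → ℝ) {n : ℕ} (x : X)
    (G : (Fin (n + 2) → X) → ℝ) (hG : ∀ (u : Fin (n + 2) → X) (σ : Equiv.Perm (Fin (n + 2))),
      G (u ∘ σ) = G u) :
    ∑ u : Fin (n + 2) → X, trialProb q u * poolCount x u * G u =
      (n + 2) * q x * ∑ ys : Fin (n + 1) → X, trialProb q ys * G (Fin.cons x ys) := by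
  -- each position contributes the same
  have hk : ∀ k : Fin (n + 2), ∑ u : Fin (n + 2) → X, (if u k = x then trialProb q u * G u else 0)
      = q x * ∑ ys : Fin (n + 1) → X, trialProb q ys * G (Fin.cons x ys) := by
    intro k
    -- move position `k` to the front by the swap `(0 k)`
    have hinv : Function.Involutive
        (fun u : Fin (n + 2) → X => u ∘ ⇑(Equiv.swap (0 : Fin (n + 2)) k)) := fun u => by
      funext i
      simp [Function.comp, Equiv.swap_apply_self]
    have step1 : ∑ u : Fin (n + 2) → X, (if u k = x then trialProb q u * G u else 0) =
        ∑ u : Fin (n + 2) → X, (if u 0 = x then trialProb q u * G u else 0) := by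
      rw [← hinv.bijective.sum_comp (fun u => if u 0 = x then trialProb q u * G u else 0)]
      refine sum_congr rfl fun u _ => ?_
      have e1 : (u ∘ ⇑(Equiv.swap (0 : Fin (n + 2)) k)) 0 = u k := by simp
      have e2 : trialProb q (u ∘ ⇑(Equiv.swap (0 : Fin (n + 2)) k)) = trialProb q u :=
        trialProb_comp_perm q u _
      have e3 : G (u ∘ ⇑(Equiv.swap (0 : Fin (n + 2)) k)) = G u := hG u _
      simp only [e1, e2, e3]
    rw [step1, ← (Fin.consEquiv fun _ => X).sum_comp, Fintype.sum_prod_type]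
    simp only [Fin.consEquiv, Equiv.coe_fn_mk, Fin.cons_zero]
    have pull : ∀ a : X, (∑ ys : Fin (n + 1) → X,
        (if a = x then trialProb q (Fin.cons a ys : Fin (n + 2) → X) *
          G (Fin.cons a ys) else 0)) =
        if a = x then ∑ ys : Fin (n + 1) → X, trialProb q (Fin.cons a ys : Fin (n + 2) → X) *
          G (Fin.cons a ys) else 0 := by
      intro a
      split_ifs <;> simp
    simp_rw [pull]
    rw [sum_ite_eq' univ x, if_pos (mem_univ _), mul_sum]
    refine sum_congr rfl fun ys _ => ?_
    rw [trialProb_cons]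
    ring
  calc ∑ u : Fin (n + 2) → X, trialProb q u * poolCount x u * G u
      = ∑ u : Fin (n + 2) → X, ∑ k, (if u k = x then trialProb q u * G u else 0) := by
        refine sum_congr rfl fun u _ => ?_
        unfold poolCount
        rw [mul_sum, sum_mul]
        refine sum_congr rfl fun k _ => ?_
        split_ifs <;> ring
    _ = ∑ k, ∑ u : Fin (n + 2) → X, (if u k = x then trialProb q u * G u else 0) := sum_comm
    _ = ∑ _k : Fin (n + 2), q x * ∑ ys : Fin (n + 1) → X, trialProb q ys * G (Fin.cons x ys) :=
        sum_congr rfl fun k _ => hk k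
    _ = (n + 2) * q x * ∑ ys : Fin (n + 1) → X, trialProb q ys * G (Fin.cons x ys) := by
        rw [sum_const, card_univ, Fintype.card_fin, nsmul_eq_mul]
        push_cast
        ring

/-- **The i-SIR kernel through the pool**:
`P_N(x, y) = w(y) · Σ_{ys} ∏q(ys) · #{members of x :: ys equal to y} / (w(x) + Σ_j w(ys_j))`
(move part: a fresh proposal equal to `y` is selected; stay part: `x` itself is re-selected).
[cite: AndrieuLeeVihola2018, §4 (first display, `P_N(x, S)` as a sum over the selected index)] -/
theorem isirKernel_eq_sum_cons (q p : X → ℝ) (n : ℕ) (x y : X) :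
    isirKernel q p (n + 1) x y = p y / q y * ∑ ys : Fin (n + 1) → X, trialProb q ys *
      (poolCount y (Fin.cons x ys : Fin (n + 2) → X) / (p x / q x + weightSum q p ys)) := by
  unfold isirKernel isirMove isirSel
  have hmove : ∀ ys : Fin (n + 1) → X, ∀ J : Fin (n + 1),
      (if ys J = y then p (ys J) / q (ys J) / (p x / q x + weightSum q p ys) else 0) =
        p y / q y * ((if ys J = y then (1 : ℝ) else 0) / (p x / q x + weightSum q p ys)) := by
    intro ys J
    split_ifs with h
    · rw [h]; ring
    · simp
  simp_rw [hmove, ← mul_sum, ← sum_div]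
  have hstay : (if y = x then isirStay q p (n + 1) x else 0) = p y / q y *
      ∑ ys : Fin (n + 1) → X, trialProb q ys * ((if x = y then (1 : ℝ) else 0) /
        (p x / q x + weightSum q p ys)) := by
    unfold isirStay
    by_cases hyx : y = x
    · subst hyx
      simp only [if_true]
      rw [mul_sum]
      exact sum_congr rfl fun ys _ => by ring
    · rw [if_neg hyx]
      simp [Ne.symm hyx]
  rw [hstay]
  simp only [mul_sum]
  rw [← sum_add_distrib]
  refine sum_congr rfl fun ys _ => ?_
  rw [poolCount_cons, add_div]
  ring

/-- **i-SIR is the marginal chain of the (state, pool) Gibbs sampler**: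
`daKernel (isirJoint q p n) = P_N` with `N = n + 2`. [cite: SamsonovEtAl2022, §2.1 ("a
systematic-scan two-stage Gibbs sampler")]; [cite: AndrieuLeeVihola2018, §3 Theorem 1 (first
bullet)] -/
theorem daKernel_isirJoint (hp : ∀ x, 0 < p x) (hq : ∀ x, 0 < q x) (hq1 : ∑ x, q x = 1) (n : ℕ) :
    daKernel (isirJoint q p n) = (isirKernel q p (n + 1) : Matrix X X ℝ) := by
  funext x y
  show (∑ u, isirJoint q p n x u / (∑ v, isirJoint q p n x v) *
      (isirJoint q p n y u / ∑ z, isirJoint q p n z u)) = isirKernel q p (n + 1) x y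
  simp_rw [sum_isirJoint_pool hq hq1, sum_isirJoint_state]
  have hwx : 0 < p x / q x := div_pos (hp x) (hq x)
  have hN : (0 : ℝ) < n + 2 := by positivity
  -- simplify each summand
  have hs : ∀ u : Fin (n + 2) → X, isirJoint q p n x u / p x *
      (isirJoint q p n y u / (trialProb q u * weightSum q p u / (n + 2))) =
      1 / ((n + 2) * q x) * (trialProb q u * poolCount x u *
        (p y / q y * poolCount y u / weightSum q p u)) := by
    intro u
    unfold isirJoint
    have hT : trialProb q u ≠ 0 := (trialProb_pos' hq u).ne'
    have hS : weightSum q p u ≠ 0 := (weightSum_pos' hp hq u).ne'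
    have hpx : p x ≠ 0 := (hp x).ne'
    have hqx : q x ≠ 0 := (hq x).ne'
    field_simp
  simp_rw [hs]
  have hne : ((n : ℝ) + 2) * q x ≠ 0 := mul_ne_zero hN.ne' (hq x).ne'
  rw [← mul_sum, sum_trialProb_mul_poolCount_mul q x _ (fun u σ => by
    rw [poolCount_comp_perm, weightSum_comp_perm]), isirKernel_eq_sum_cons q p n x y, ← mul_assoc,
    one_div_mul_cancel hne, one_mul, mul_sum]
  refine sum_congr rfl fun ys _ => ?_
  rw [weightSum_cons]
  ring

/-! ## Consequences: positivity and the variance lower bound -/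

section Consequences

/-- Every entry of the i-SIR kernel is positive (helper). [folklore] -/
private theorem isirKernel_pos' (hp : ∀ x, 0 < p x) (hq : ∀ x, 0 < q x) (n : ℕ) (x y : X) :
    0 < isirKernel q p (n + 1) x y := by
  haveI : Nonempty X := ⟨x⟩
  have hmove : 0 < isirMove q p (n + 1) x y := by
    rw [isirMove_eq hq]
    exact mul_pos (mtmH_pos hp hq n (add_pos (div_pos (hp x) (hq x)) (div_pos (hp y) (hq y))))
      (hp y)
  unfold isirKernel
  split_ifs
  · linarith [isirStay_nonneg hp hq (n + 1) x]
  · rw [add_zero]; exact hmove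

/-- **Andrieu–Lee–Vihola, Theorem 1 (first bullet), finite form: the i-SIR kernel is a POSITIVE
operator on `ℓ²(p)`** — `⟨h, P_N h⟩_p ≥ 0` for every `h` (it is the marginal chain of a
two-component Gibbs sampler, `daKernel_isirJoint`, and such chains are positive,
`DataAugmentationAutocovariance.piInner_daKernel_mulVec_nonneg`). Hence all stationary
autocorrelations of i-SIR are non-negative at lag one. [cite: AndrieuLeeVihola2018, §3 Theorem 1
(first bullet), §1 (first bullet)] -/
theorem piInner_isirKernel_mulVec_nonneg (hp : ∀ x, 0 < p x) (hq : ∀ x, 0 < q x)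
    (hq1 : ∑ x, q x = 1) (n : ℕ) (h : X → ℝ) :
    0 ≤ piInner p h ((isirKernel q p (n + 1) : Matrix X X ℝ) *ᵥ h) := by
  have hmarg : (fun x => ∑ u, isirJoint q p n x u) = p := funext (sum_isirJoint_pool hq hq1 n)
  have h1 := piInner_daKernel_mulVec_nonneg (J := isirJoint q p n)
    (fun x u => div_nonneg (mul_nonneg (mul_nonneg (trialProb_pos' hq u).le
      (div_pos (hp x) (hq x)).le) (poolCount_nonneg x u)) (by positivity))
    (fun x => by rw [sum_isirJoint_pool hq hq1 n x]; exact hp x)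
    (fun u => by
      rw [sum_isirJoint_state]
      exact div_pos (mul_pos (trialProb_pos' hq u) (weightSum_pos' hp hq u)) (by positivity)) h
  rwa [hmarg, daKernel_isirJoint hp hq hq1 n] at h1

/-- **Andrieu–Lee–Vihola, Theorem 1 (third display, lower bound), finite form**: for every `f`,
`var_p(f) ≤ v(f, p, P_N)` — with `N − 1 = n + 1` fresh proposals per update, i-SIR's asymptotic
variance is never below that of independent sampling from `p` (its autocovariances are
non-negative). [cite: AndrieuLeeVihola2018, §3 Theorem 1 ("`var_π(f) ≤ var(f, P_N)`")] -/
theorem var_le_asympVar_isir (hp : ∀ x, 0 < p x) (hp1 : ∑ x, p x = 1) (hq : ∀ x, 0 < q x)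
    (hq1 : ∑ x, q x = 1) (n : ℕ) (f : X → ℝ) :
    piInner p f f - (∑ x, p x * f x) ^ 2 ≤ asympVar f p (isirKernel q p (n + 1) : Matrix X X ℝ) := by
  have hK := daKernel_isirJoint hp hq hq1 n
  have hirr : IsIrreducible (daKernel (isirJoint q p n)) := fun x y =>
    ⟨1, by rw [pow_one, hK]; exact isirKernel_pos' hp hq n x y⟩
  have h1 := var_le_asympVar_daKernel (J := isirJoint q p n)
    (fun x u => div_nonneg (mul_nonneg (mul_nonneg (trialProb_pos' hq u).le
      (div_pos (hp x) (hq x)).le) (poolCount_nonneg x u)) (by positivity))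
    (fun x => by rw [sum_isirJoint_pool hq hq1 n x]; exact hp x)
    (fun u => by
      rw [sum_isirJoint_state]
      exact div_pos (mul_pos (trialProb_pos' hq u) (weightSum_pos' hp hq u)) (by positivity))
    (by simp_rw [sum_isirJoint_pool hq hq1 n]; exact hp1) hirr f
  have h2 : ∀ x, ∑ u, isirJoint q p n x u = p x := sum_isirJoint_pool hq hq1 n
  simp only [h2, hK] at h1
  exact h1

end Consequences

end Literature.Probability.MarkovChains
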